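import Literature.NumberTheory.EllipticCurves.CastellaGrossiLeeSkinner2022.HowardDivisibilityAnyClassNumber
import Literature.NumberTheory.EllipticCurves.IwasawaAlgebraProofs
import Literature.NumberTheory.EllipticCurves.IwasawaAlgebraMuVanishingProofs
import HarnessLib

/-!
# Envelope transfer and `μ`-cancellation for characteristic ideals of quotients `𝔖/ℋ`
# (module theory over a Noetherian domain / over `Λ = ℤ_p⟦T⟧`; proofs file)

Topic `NumberTheory/EllipticCurves`. THEOREMS ONLY (no definition, no named fact, no `sorry`), on the
vocabulary of `IwasawaAlgebra.lean` (`Module.charIdeal`, `muInvariant`), `HeegnerModuleIndex.lean`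
(`heegnerModule`, `heegnerCharIdeal`) and `CastellaGrossiLeeSkinner2022/HowardDivisibilityAnyClassNumber.lean`
(`stabilizedHeegnerModule`, `stabilizedHeegnerCharIdeal`). Written by the lead of line `torsion-depth-x10b`
(crux stmt-BirchSwinnertonDyer-23729 `PrintX10b.HowardContainmentAnyClassNumberX10b`, seat `bsd-line-x10b-p2`)
to make precise, BY NAME, what the PROMOTION step "localized containment `(p^m T^n)·I(Λκ_∞)² ⊆ char(𝒳_tors)`
⟹ integral containment `I(ℋ_F)² ⊆ char(𝒳_tors)`" consists of beyond bookkeeping: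
(i) a submodule inclusion between the tree family's Heegner module `ℋ_F` and CGLS's stabilised module
`Λκ_∞` (vertical distribution relations + generation of `lim← H_k` by the stabilised class: Howard 2004
Thm. 3.3.7 / Perrin-Riou 1987 §3.4 Prop. 10 at any class number — NOT in the tree, NOT proved here);
(ii) `𝔖_p(K_∞)` finitely generated with `𝔖/ℋ` torsion (Howard Thm. B (a) + Cornut–Vatsal; NOT here) —
without (ii) the tree's `Module.charIdeal` is NOT monotone (junk values: `char(Λ) = ⊤`, `char(Λ/p) = (p)`);
(iii) `μ(𝒳_tors) = 0` to cancel the `p^m` (the `μ`-part). HONEST FRAMING: pure algebra plus two one-line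
specialisations; nothing about elliptic curves is asserted; BSD is not proved by any of this.

WHAT.
* `Module.charIdeal_quotient_le_of_le` — `R` a Noetherian domain, `S` a finitely generated `R`-module,
  `H ≤ H'` submodules with `S ⧸ H` torsion: `char_R(S ⧸ H) ≤ char_R(S ⧸ H')`
  (multiplicativity `Module.charIdeal_eq_mul_of_exact` on `0 → H'/H → S/H → S/H' → 0`).
* `heegnerCharIdeal_le_stabilizedHeegnerCharIdeal_of_le` / `stabilizedHeegnerCharIdeal_le_heegnerCharIdeal_of_le`
  — the two specialisations: `I(ℋ_F) ⊆ I(Λκ_C)` if `ℋ_F ⊆ Λκ_C` (resp. the reverse), given (ii).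
* (private helper `le_span_singleton_of_span_pow_mul_le`) — in a UFD, `f` prime, `f ∤ g`:
  `(f^n)·I ⊆ (g) ⟹ I ⊆ (g)` (Euclid's lemma; the same helper serves `f = T`).
* `IwasawaAlgebra.le_charIdeal_of_span_pow_mul_le_of_muInvariant_eq_zero` — `M` f.g. torsion over `Λ`
  with `μ(M) = 0`: `(p^m)·I ⊆ char(M) ⟹ I ⊆ char(M)` (`char(M)` is principal,
  `charIdeal_isPrincipal_holds`; `μ = 0 ↔ p ∤ generator`, `muInvariant_eq_zero_iff_not_C_dvd_of_charIdeal_eq_span`).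

References: [NeukirchSchmidtWingberg2008] Ch. V §3 (multiplicativity of characteristic ideals);
[Washington1997] §13.2 (`μ`, characteristic power series); [CastellaGrossiLeeSkinner2022] Thm. 4.1.3 and
Rem. 4.1.4 (the localized containment and `Λκ_∞`); [Howard2004HeegnerKolyvagin] Thm. B, Thm. 3.3.7;
[PerrinRiou1987BSMF] §3.4 Prop. 10.
-/

set_option autoImplicit false

noncomputable section

open scoped Classical

namespace Literature.NumberTheory.EllipticCurves

/-! ## (E) Envelope transfer: `char(S/H) ⊆ char(S/H')` for `H ⊆ H'`, `S/H` torsion -/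

namespace Module

variable {R : Type*} [CommRing R] [IsNoetherianRing R] [IsDomain R]
  {S : Type*} [AddCommGroup S] [_root_.Module R S]

/-- **Envelope transfer for characteristic ideals.** For a finitely generated module `S` over a
Noetherian domain and submodules `H ≤ H'` with `S ⧸ H` torsion, `char(S ⧸ H) ⊆ char(S ⧸ H')`: the
sequence `0 → H'/H → S/H → S/H' → 0` is exact, so `char(S/H) = char(H'/H) · char(S/H') ⊆ char(S/H')`
(`Module.charIdeal_eq_mul_of_exact`). The torsion hypothesis is necessary with the tree's
`Module.charIdeal` (a non-torsion module has `char = ⊤`). [cite: NeukirchSchmidtWingberg2008, Ch. V §3, Remark 2 after (5.3.9)] -/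
theorem charIdeal_quotient_le_of_le [_root_.Module.Finite R S] {H H' : Submodule R S} (hle : H ≤ H')
    (htor : _root_.Module.IsTorsion R (S ⧸ H)) :
    charIdeal R (S ⧸ H) ≤ charIdeal R (S ⧸ H') := by
  set g : (S ⧸ H) →ₗ[R] (S ⧸ H') := Submodule.mapQ H H' LinearMap.id (by simpa using hle) with hg_def
  have hg : Function.Surjective g := by
    intro y
    obtain ⟨x, rfl⟩ := Submodule.Quotient.mk_surjective H' y
    exact ⟨Submodule.Quotient.mk x, by simp [hg_def, Submodule.mapQ_apply]⟩
  have h := charIdeal_eq_mul_of_exact (R := R) (M := S ⧸ H) htor (LinearMap.ker g).subtype g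
    (LinearMap.ker g).injective_subtype hg (LinearMap.exact_subtype_ker_map g)
  rw [h]
  exact Ideal.mul_le_left

end Module

/-! ## (E') The two specialisations to the Heegner vocabulary -/

section Heegner

open WeierstrassCurve CastellaGrossiLeeSkinner2022

universe u

variable {K : Type u} [Field K] [NumberField K] {N : ℕ} [NeZero N] {W : WeierstrassCurve ℚ}
  [W.IsGloballyMinimal] {p : ℕ} [Fact p.Prime] {κ : ZpExtension K p} {γ : Field.absoluteGaloisGroup K}
  {jbar : AlgebraicClosure K →+* ℂ}

/-- **`ℋ_F ⊆ Λκ_C ⟹ I(ℋ_F) ⊆ I(Λκ_C)`** (the direction the containment `I(ℋ_F)² ⊆ char(𝒳_tors)` is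
fed by): for a finitely generated `Λ`-adic Selmer module `𝔖 = D.S` with `𝔖/ℋ_F` torsion, if the tree
Heegner module of the family `F` lies in CGLS's stabilised module of `C`, then
`heegnerCharIdeal D F ≤ stabilizedHeegnerCharIdeal D C`. The inclusion itself (distribution relations +
generation of `lim← H_k` by the stabilised class, Howard 2004 Thm. 3.3.7 / Perrin-Riou 1987 Prop. 10 at
any class number) is a HYPOTHESIS here. [cite: CastellaGrossiLeeSkinner2022, Rem. 4.1.4 ("generate the same Λ-submodule")]
[cite: Howard2004HeegnerKolyvagin, Thm. 3.3.7] [cite: PerrinRiou1987BSMF, §3.4 Prop. 10] -/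
theorem heegnerCharIdeal_le_stabilizedHeegnerCharIdeal_of_le
    (D : (W.baseChange K).LambdaAdicSelmerData κ γ) [Module.Finite (IwasawaAlgebra p) D.S]
    (F : HeegnerFamily N W K κ jbar) (C : StabilizedHeegnerData N W K κ jbar)
    (htor : Module.IsTorsion (IwasawaAlgebra p) (D.S ⧸ heegnerModule D F))
    (hle : heegnerModule D F ≤ stabilizedHeegnerModule D C) :
    heegnerCharIdeal D F ≤ stabilizedHeegnerCharIdeal D C :=
  Module.charIdeal_quotient_le_of_le hle htor

/-- **`Λκ_C ⊆ ℋ_F ⟹ I(Λκ_C) ⊆ I(ℋ_F)`** (the reverse direction: CGLS's stabilised class lies in the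
tree family's module — the "envelope"; then print's bound by `I(Λκ_∞)` says nothing sharper about
`I(ℋ_F)`), for `𝔖` finitely generated with `𝔖/Λκ_C` torsion. The inclusion is a HYPOTHESIS.
[cite: CastellaGrossiLeeSkinner2022, Rem. 4.1.4 and the module-mismatch caution of the tree's typing] -/
theorem stabilizedHeegnerCharIdeal_le_heegnerCharIdeal_of_le
    (D : (W.baseChange K).LambdaAdicSelmerData κ γ) [Module.Finite (IwasawaAlgebra p) D.S]
    (F : HeegnerFamily N W K κ jbar) (C : StabilizedHeegnerData N W K κ jbar)
    (htor : Module.IsTorsion (IwasawaAlgebra p) (D.S ⧸ stabilizedHeegnerModule D C))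
    (hle : stabilizedHeegnerModule D C ≤ heegnerModule D F) :
    stabilizedHeegnerCharIdeal D C ≤ heegnerCharIdeal D F :=
  Module.charIdeal_quotient_le_of_le hle htor

end Heegner

/-! ## (M) Cancelling a prime power against a principal ideal prime to it; the `μ = 0` case -/

/-- **Euclid's lemma for ideals of a UFD:** if `f` is prime, `f ∤ g` and `(f^n) · I ⊆ (g)`, then
`I ⊆ (g)` — every `x ∈ I` has `g ∣ f^n x`, and `g`, `f^n` have no common prime factor.
(`g = 0` is allowed: then `f^n x = 0` forces `x = 0`.) [folklore] -/
private theorem le_span_singleton_of_span_pow_mul_le {R : Type*} [CommRing R] [IsDomain R]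
    [UniqueFactorizationMonoid R] {f g : R} (hf : Prime f) (hfg : ¬ f ∣ g) {I : Ideal R} {n : ℕ}
    (h : Ideal.span {f ^ n} * I ≤ Ideal.span {g}) : I ≤ Ideal.span {g} := by
  intro x hx
  have hmem : f ^ n * x ∈ Ideal.span {g} :=
    h (Ideal.mul_mem_mul (Ideal.mem_span_singleton_self _) hx)
  rw [Ideal.mem_span_singleton] at hmem ⊢
  by_cases hg : g = 0
  · subst hg
    rw [zero_dvd_iff] at hmem ⊢
    exact (mul_eq_zero.mp hmem).resolve_left (pow_ne_zero n hf.ne_zero)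
  · refine UniqueFactorizationMonoid.dvd_of_dvd_mul_right_of_no_prime_factors hg ?_ hmem
    intro d hdg hdf hd
    exact hfg ((hd.associated_of_dvd hf (hd.dvd_of_dvd_pow hdf)).symm.dvd.trans hdg)

namespace IwasawaAlgebra

variable {p : ℕ} [Fact p.Prime]

/-- **`μ = 0` cancels the power of `p`:** for a finitely generated torsion `Λ`-module `M` with
`μ(M) = 0` and any ideal `I`, `(p^m) · I ⊆ char_Λ(M)` implies `I ⊆ char_Λ(M)`. Indeed `char(M) = (g)`
is principal (`charIdeal_isPrincipal_holds`), `μ(M) = 0 ↔ p ∤ g`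
(`muInvariant_eq_zero_iff_not_C_dvd_of_charIdeal_eq_span`), and `p` is a prime element of the UFD `Λ`
(`IwasawaAlgebra.prime_C`). This is the kernel form of "the `μ`-part of the localized containment
`(p^m)·I(ℋ)² ⊆ char(𝒳_tors)` is removed by `μ(𝒳_tors) = 0`". [cite: Washington1997, §13.2] -/
theorem le_charIdeal_of_span_pow_mul_le_of_muInvariant_eq_zero
    (M : Type*) [AddCommGroup M] [_root_.Module (IwasawaAlgebra p) M]
    [Module.Finite (IwasawaAlgebra p) M] (hM : Module.IsTorsion (IwasawaAlgebra p) M)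
    (hμ : muInvariant p M = 0) {I : Ideal (IwasawaAlgebra p)} {m : ℕ}
    (h : Ideal.span {(p : IwasawaAlgebra p) ^ m} * I ≤ Module.charIdeal (IwasawaAlgebra p) M) :
    I ≤ Module.charIdeal (IwasawaAlgebra p) M := by
  obtain ⟨g, hg⟩ := (charIdeal_isPrincipal_holds p M).principal
  have hg' : Module.charIdeal (IwasawaAlgebra p) M = Ideal.span {g} := hg
  have hndvd : ¬ PowerSeries.C (p : ℤ_[p]) ∣ g :=
    (muInvariant_eq_zero_iff_not_C_dvd_of_charIdeal_eq_span M hM hg').mp hμ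
  have hp : (p : IwasawaAlgebra p) = PowerSeries.C (p : ℤ_[p]) := by
    rw [map_natCast]
  rw [hg'] at h ⊢
  rw [hp] at h
  exact le_span_singleton_of_span_pow_mul_le (prime_C p) hndvd h

end IwasawaAlgebra

end Literature.NumberTheory.EllipticCurves

end
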